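import Mathlib
import Summits.MatrixMultiplication.MatrixMultiplication.Theorems.SnSubsetDichotomyThresholdSubsetTriplesStubRhSwap

/-!
# `ThresholdSubsetTriples` (crux stmt-MatrixMultiplication-10882), line `SketchIdeator6`:
# counting block-preserving permutations with many cycles

Negative-side helper (line lead c6, 2026-08-17; `sorry`-free, standard axioms).  The genus certificate
of `stub_genusThreshold` forces (N1, `Negative.three_le_cyc_add`) the cycle counts of the quotients of a
design to be LARGE; this file supplies the matching COUNT of permutations with many cycles inside a
Young subgroup, the engine of the block-structured refutation
(`Negative/GenusBlockStructured.lean`).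

For a block labelling `l : Fin n → Fin n` with blocks of size `≤ B`:

* `card_blockPerm_le` — the number of permutations `σ` preserving `l` (`l ∘ σ = l`), with exactly
  `n − j` cycles (`cyc σ + j = n`, `cyc σ = Nat.card (orbitRel.Quotient (zpowers σ) (Fin n))`) and with
  support inside `{x | x < c}`, is at most `choose c j · B ^ j`.  Proof: induction on `c`; a permutation
  moving the top point `p = c` is `swap (σ p) p * τ` with `τ` fixing `p` and having ONE MORE cycle
  (tree `stub_rhSwap`, split case: `σ p` and `p` share a cycle of `σ`), and `σ p` ranges over the
  `≤ B` points of the block of `p` — Pascal's rule closes the induction.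
* `card_le_sum_choose_of_blockQuotients` — a set `X ⊆ S_n` whose quotients `s s'⁻¹` all preserve `l`
  and whose non-trivial quotients all have at least `n − J` cycles has
  `|X| ≤ ∑_{j ≤ J} choose n j · B ^ j` (translate by a fixed `s₀ ∈ X` and count);
  `card_mul_factorial_le_of_blockQuotients` — the cleared form `|X| · J! ≤ (J+1) · (nB)^J` (`J ≤ nB`).

References: crux workfile `Census-c6b-GenusCalibration.md` §3; Lines/SketchIdeator6.lean (skeleton v4).
-/

set_option linter.dupNamespace false

open scoped Classical

namespace Summit.MatrixMultiplication.MatrixMultiplication.Theorems.ThresholdSubsetTriples.Negative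

open MulAction Equiv Equiv.Perm Finset
open Summit.MatrixMultiplication.MatrixMultiplication.Theorems.ThresholdSubsetTriples (stub_rhSwap)

variable {n : ℕ}

/-- An orbit quotient of `Fin n` has at most `n` classes (restated locally; see also
`Negative.card_orbitQuotient_le` in `GenusCertificateRules`). -/
theorem orbitQuotient_card_le_n (H : Subgroup (Perm (Fin n))) :
    Nat.card (orbitRel.Quotient H (Fin n)) ≤ n := by
  have h := Nat.card_le_card_of_surjective
    (Quotient.mk (orbitRel H (Fin n)) : Fin n → orbitRel.Quotient H (Fin n)) Quotient.mk_surjective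
  simpa using h

/-- The identity permutation of `Fin n` has `n` cycles (orbits of the trivial group are points). -/
theorem card_orbitQuotient_zpowers_one :
    Nat.card (orbitRel.Quotient (Subgroup.zpowers (1 : Perm (Fin n))) (Fin n)) = n := by
  refine le_antisymm (orbitQuotient_card_le_n _) ?_
  have h := Nat.card_le_card_of_injective
    (Quotient.mk (orbitRel (Subgroup.zpowers (1 : Perm (Fin n))) (Fin n)) :
      Fin n → orbitRel.Quotient (Subgroup.zpowers (1 : Perm (Fin n))) (Fin n)) ?_
  · simpa using h
  · intro x y hxy
    have hrel : x ∈ orbit (Subgroup.zpowers (1 : Perm (Fin n))) y := by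
      rw [← orbitRel_apply]
      exact Quotient.exact hxy
    obtain ⟨⟨g, hg⟩, rfl⟩ := hrel
    rw [Subgroup.zpowers_one_eq_bot, Subgroup.mem_bot] at hg
    subst hg
    rfl

/-- Multiplying on the left by the transposition `(σ p, p)` (with `σ p ≠ p`) SPLITS the cycle of `p`:
the cycle count goes up by exactly one (tree `stub_rhSwap`, split case). -/
theorem card_orbitQuotient_swap_apply_mul (σ : Perm (Fin n)) (p : Fin n) (hp : σ p ≠ p) :
    Nat.card (orbitRel.Quotient (Subgroup.zpowers (swap (σ p) p * σ)) (Fin n)) =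
      Nat.card (orbitRel.Quotient (Subgroup.zpowers σ) (Fin n)) + 1 := by
  have hsc : σ.SameCycle (σ p) p := sameCycle_apply_left.2 (SameCycle.refl σ p)
  exact ((stub_rhSwap (Fin n) σ (σ p) p hp).1 hsc).2.2.2

/-- A labelling is invariant under the transposition of two points with the same label. -/
theorem apply_swap_eq_of_eq (l : Fin n → Fin n) {a b : Fin n} (hab : l a = l b) (x : Fin n) :
    l (swap a b x) = l x := by
  rcases eq_or_ne x a with rfl | hxa
  · rw [swap_apply_left]; exact hab.symm
  rcases eq_or_ne x b with rfl | hxb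
  · rw [swap_apply_right]; exact hab
  rw [swap_apply_of_ne_of_ne hxa hxb]

/-- **Counting block-preserving permutations with many cycles.**  For a labelling `l` of `Fin n` whose
label classes ("blocks") have at most `B` points, the permutations preserving `l`, having exactly
`n − j` cycles and fixing every point `≥ c`, number at most `choose c j · B ^ j`. -/
theorem card_blockPerm_le (l : Fin n → Fin n) (B : ℕ)
    (hB : ∀ i : Fin n, (univ.filter (fun x : Fin n => l x = i)).card ≤ B) :
    ∀ (c j : ℕ), (univ.filter (fun σ : Perm (Fin n) => (∀ x, l (σ x) = l x) ∧
        Nat.card (orbitRel.Quotient (Subgroup.zpowers σ) (Fin n)) + j = n ∧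
        ∀ x : Fin n, c ≤ x.val → σ x = x)).card ≤ c.choose j * B ^ j := by
  intro c
  induction c with
  | zero =>
    intro j
    -- only the identity fixes every point; it has `n` cycles, so `j = 0`
    have hsub : (univ.filter (fun σ : Perm (Fin n) => (∀ x, l (σ x) = l x) ∧
        Nat.card (orbitRel.Quotient (Subgroup.zpowers σ) (Fin n)) + j = n ∧
        ∀ x : Fin n, 0 ≤ x.val → σ x = x)) ⊆
        (if j = 0 then {1} else ∅ : Finset (Perm (Fin n))) := by
      intro σ hσ
      simp only [mem_filter, mem_univ, true_and] at hσ
      obtain ⟨-, hc, hfix⟩ := hσ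
      have h1 : σ = 1 := Equiv.ext fun x => by simpa using hfix x (Nat.zero_le _)
      subst h1
      rw [card_orbitQuotient_zpowers_one] at hc
      have hj : j = 0 := by omega
      subst hj
      simp
    refine (card_le_card hsub).trans ?_
    split_ifs with hj
    · subst hj; simp
    · simp
  | succ c ih =>
    intro j
    by_cases hcn : c < n
    swap
    · -- `c ≥ n`: the support condition is vacuous at `c` and at `c + 1`
      refine le_trans (le_trans (card_le_card ?_) (ih j)) ?_
      · intro σ hσ
        simp only [mem_filter, mem_univ, true_and] at hσ ⊢
        exact ⟨hσ.1, hσ.2.1, fun x hx => absurd (lt_of_lt_of_le x.isLt (not_lt.mp hcn)) (not_lt.mpr hx)⟩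
      · exact Nat.mul_le_mul_right _ (Nat.choose_le_choose j (Nat.le_succ c))
    -- `c < n`: split on whether the top point `p = c` is moved
    set p : Fin n := ⟨c, hcn⟩ with hpdef
    set F : ℕ → ℕ → Finset (Perm (Fin n)) := fun j c => univ.filter (fun σ : Perm (Fin n) =>
        (∀ x, l (σ x) = l x) ∧ Nat.card (orbitRel.Quotient (Subgroup.zpowers σ) (Fin n)) + j = n ∧
        ∀ x : Fin n, c ≤ x.val → σ x = x) with hFdef
    change (F j (c + 1)).card ≤ (c + 1).choose j * B ^ j
    have ih' : ∀ j, (F j c).card ≤ c.choose j * B ^ j := ih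
    -- the part fixing `p` lies in `F j c`
    have hfix : ((F j (c + 1)).filter (fun σ => σ p = p)) ⊆ F j c := by
      intro σ hσ
      simp only [hFdef, mem_filter, mem_univ, true_and] at hσ ⊢
      obtain ⟨⟨hl, hc, hsupp⟩, hσp⟩ := hσ
      refine ⟨hl, hc, fun x hx => ?_⟩
      rcases Nat.eq_or_lt_of_le hx with hxc | hxc
      · have : x = p := Fin.ext hxc.symm
        rw [this]; exact hσp
      · exact hsupp x hxc
    -- the part moving `p`: peel off the transposition `(σ p, p)`
    set Cand : Finset (Fin n) := univ.filter (fun a : Fin n => l a = l p ∧ a.val < c) with hCand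
    have hCandB : Cand.card ≤ B := by
      refine le_trans (card_le_card ?_) (hB (l p))
      intro a ha
      simp only [hCand, mem_filter, mem_univ, true_and] at ha ⊢
      exact ha.1
    -- facts about a permutation of `F j (c+1)` moving `p`
    have key : ∀ σ ∈ (F j (c + 1)).filter (fun σ => σ p ≠ p),
        (σ p).val < c ∧ l (σ p) = l p ∧ 1 ≤ j ∧
        (swap (σ p) p * σ) ∈ F (j - 1) c := by
      intro σ hσ
      simp only [hFdef, mem_filter, mem_univ, true_and] at hσ
      obtain ⟨⟨hl, hc, hsupp⟩, hσp⟩ := hσ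
      -- `σ p < c`
      have hle : (σ p).val ≤ c := by
        by_contra hlt
        have h1 : σ (σ p) = σ p := hsupp (σ p) (by omega)
        exact hσp (σ.injective h1)
      have hne : (σ p).val ≠ c := fun h => hσp (Fin.ext h)
      have hlt : (σ p).val < c := lt_of_le_of_ne hle hne
      have hlab : l (σ p) = l p := hl p
      have hcyc := card_orbitQuotient_swap_apply_mul σ p hσp
      have hτle := orbitQuotient_card_le_n (n := n) (Subgroup.zpowers (swap (σ p) p * σ))
      have hj : 1 ≤ j := by omega
      refine ⟨hlt, hlab, hj, ?_⟩
      simp only [hFdef, mem_filter, mem_univ, true_and]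
      refine ⟨fun x => ?_, by omega, fun x hx => ?_⟩
      · rw [Perm.mul_apply, apply_swap_eq_of_eq l hlab, hl]
      · rcases eq_or_ne x p with rfl | hxp
        · rw [Perm.mul_apply, swap_apply_left]
        · have hxc : c + 1 ≤ x.val := by
            have : x.val ≠ c := fun h => hxp (Fin.ext h)
            omega
          rw [Perm.mul_apply, hsupp x hxc]
          refine swap_apply_of_ne_of_ne ?_ hxp
          intro h
          rw [h] at hx
          omega
    have hmove : ((F j (c + 1)).filter (fun σ => σ p ≠ p)).card ≤ (F (j - 1) c).card * Cand.card := by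
      rw [← card_product]
      refine card_le_card_of_injOn (t := F (j - 1) c ×ˢ Cand)
        (fun σ => (swap (σ p) p * σ, σ p)) ?_ ?_
      · intro σ hσ
        obtain ⟨hlt, hlab, -, hmem⟩ := key σ (by exact_mod_cast hσ)
        rw [Finset.mem_coe, Finset.mem_product]
        refine ⟨hmem, ?_⟩
        simp only [hCand, mem_filter, mem_univ, true_and]
        exact ⟨hlab, hlt⟩
      · intro σ₁ _ σ₂ _ h
        simp only [Prod.mk.injEq] at h
        obtain ⟨h1, h2⟩ := h
        rw [h2] at h1
        exact mul_left_cancel h1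
    -- assemble with Pascal's rule
    have hsplit := card_filter_add_card_filter_not (s := F j (c + 1)) (fun σ => σ p = p)
    rcases Nat.eq_zero_or_pos j with hj0 | hjpos
    · -- no permutation of `F 0 (c+1)` moves `p`
      subst hj0
      have hempty : ((F 0 (c + 1)).filter (fun σ => σ p ≠ p)).card = 0 := by
        rw [card_eq_zero, filter_eq_empty_iff]
        intro σ hσ hσp
        have := (key σ (mem_filter.2 ⟨hσ, hσp⟩)).2.2.1
        omega
      have h1 : (F 0 (c + 1)).card ≤ (F 0 c).card := by
        rw [← hsplit, hempty, add_zero]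
        exact card_le_card hfix
      refine h1.trans ((ih' 0).trans ?_)
      simp
    · obtain ⟨j', rfl⟩ : ∃ j', j = j' + 1 := ⟨j - 1, by omega⟩
      have hj' : j' + 1 - 1 = j' := by omega
      rw [hj'] at hmove
      calc (F (j' + 1) (c + 1)).card
          = ((F (j' + 1) (c + 1)).filter (fun σ => σ p = p)).card +
              ((F (j' + 1) (c + 1)).filter (fun σ => σ p ≠ p)).card := hsplit.symm
        _ ≤ (F (j' + 1) c).card + (F j' c).card * Cand.card :=
            Nat.add_le_add (card_le_card hfix) hmove
        _ ≤ c.choose (j' + 1) * B ^ (j' + 1) + c.choose j' * B ^ j' * B :=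
            Nat.add_le_add (ih' (j' + 1)) (Nat.mul_le_mul (ih' j') hCandB)
        _ = (c + 1).choose (j' + 1) * B ^ (j' + 1) := by
            rw [Nat.choose_succ_succ', pow_succ]; ring

/-- **Translate and count.**  If all quotients `s s'⁻¹` of `X ⊆ S_n` preserve the labelling `l`
(blocks of size `≤ B`) and every non-trivial quotient has at least `n − J` cycles, then
`|X| ≤ ∑_{j ≤ J} choose n j · B ^ j`. -/
theorem card_le_sum_choose_of_blockQuotients (X : Finset (Perm (Fin n))) (l : Fin n → Fin n) (B : ℕ)
    (hB : ∀ i : Fin n, (univ.filter (fun x : Fin n => l x = i)).card ≤ B)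
    (hl : ∀ s ∈ X, ∀ s' ∈ X, ∀ x, l ((s * s'⁻¹) x) = l x) (J : ℕ)
    (hJ : ∀ s ∈ X, ∀ s' ∈ X, s ≠ s' →
      n ≤ Nat.card (orbitRel.Quotient (Subgroup.zpowers (s * s'⁻¹)) (Fin n)) + J) :
    X.card ≤ ∑ j ∈ range (J + 1), n.choose j * B ^ j := by
  rcases X.eq_empty_or_nonempty with rfl | ⟨s₀, hs₀⟩
  · simp
  set F : ℕ → Finset (Perm (Fin n)) := fun j => univ.filter (fun σ : Perm (Fin n) =>
      (∀ x, l (σ x) = l x) ∧ Nat.card (orbitRel.Quotient (Subgroup.zpowers σ) (Fin n)) + j = n ∧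
      ∀ x : Fin n, n ≤ x.val → σ x = x) with hFdef
  have hF : ∀ j, (F j).card ≤ n.choose j * B ^ j := fun j => card_blockPerm_le l B hB n j
  have hmaps : ∀ s ∈ X, s * s₀⁻¹ ∈ (range (J + 1)).biUnion F := by
    intro s hs
    have hcy := orbitQuotient_card_le_n (n := n) (Subgroup.zpowers (s * s₀⁻¹))
    set cy := Nat.card (orbitRel.Quotient (Subgroup.zpowers (s * s₀⁻¹)) (Fin n)) with hcydef
    have hjJ : n - cy ≤ J := by
      rcases eq_or_ne s s₀ with rfl | hne
      · have : cy = n := by rw [hcydef, mul_inv_cancel, card_orbitQuotient_zpowers_one]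
        omega
      · have := hJ s hs s₀ hs₀ hne
        omega
    rw [mem_biUnion]
    refine ⟨n - cy, mem_range.2 (Nat.lt_succ_of_le hjJ), ?_⟩
    simp only [hFdef, mem_filter, mem_univ, true_and]
    exact ⟨hl s hs s₀ hs₀, by omega, fun x hx => absurd x.isLt (not_lt.mpr hx)⟩
  calc X.card ≤ ((range (J + 1)).biUnion F).card :=
        card_le_card_of_injOn (fun s => s * s₀⁻¹) hmaps (fun s₁ _ s₂ _ h => mul_right_cancel h)
    _ ≤ ∑ j ∈ range (J + 1), (F j).card := card_biUnion_le
    _ ≤ ∑ j ∈ range (J + 1), n.choose j * B ^ j := sum_le_sum fun j _ => hF j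

/-- Clearing denominators: `choose n j · B^j · J! ≤ (nB)^J` for `j ≤ J ≤ nB`. -/
theorem choose_mul_pow_mul_factorial_le {N B J j : ℕ} (hj : j ≤ J) (hJ : J ≤ N * B) :
    N.choose j * B ^ j * J.factorial ≤ (N * B) ^ J := by
  have h1 : N.choose j * j.factorial ≤ N ^ j := by
    rw [mul_comm, ← Nat.descFactorial_eq_factorial_mul_choose]
    exact Nat.descFactorial_le_pow N j
  have h2 : j.factorial * J.descFactorial (J - j) = J.factorial := by
    have := Nat.factorial_mul_descFactorial (Nat.sub_le J j)
    rwa [Nat.sub_sub_self hj] at this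
  have h3 : J.descFactorial (J - j) ≤ (N * B) ^ (J - j) :=
    (Nat.descFactorial_le_pow J (J - j)).trans (Nat.pow_le_pow_left hJ _)
  calc N.choose j * B ^ j * J.factorial
      = (N.choose j * j.factorial) * B ^ j * J.descFactorial (J - j) := by rw [← h2]; ring
    _ ≤ N ^ j * B ^ j * (N * B) ^ (J - j) :=
        Nat.mul_le_mul (Nat.mul_le_mul_right _ h1) h3
    _ = (N * B) ^ J := by
        rw [← mul_pow, ← pow_add, Nat.add_sub_cancel' hj]

/-- **Cleared form.**  Under the hypotheses of `card_le_sum_choose_of_blockQuotients` and `J ≤ nB`: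
`|X| · J! ≤ (J + 1) · (nB)^J`. -/
theorem card_mul_factorial_le_of_blockQuotients (X : Finset (Perm (Fin n))) (l : Fin n → Fin n)
    (B : ℕ) (hB : ∀ i : Fin n, (univ.filter (fun x : Fin n => l x = i)).card ≤ B)
    (hl : ∀ s ∈ X, ∀ s' ∈ X, ∀ x, l ((s * s'⁻¹) x) = l x) (J : ℕ) (hJn : J ≤ n * B)
    (hJ : ∀ s ∈ X, ∀ s' ∈ X, s ≠ s' →
      n ≤ Nat.card (orbitRel.Quotient (Subgroup.zpowers (s * s'⁻¹)) (Fin n)) + J) :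
    X.card * J.factorial ≤ (J + 1) * (n * B) ^ J := by
  have h := card_le_sum_choose_of_blockQuotients X l B hB hl J hJ
  calc X.card * J.factorial ≤ (∑ j ∈ range (J + 1), n.choose j * B ^ j) * J.factorial :=
        Nat.mul_le_mul_right _ h
    _ = ∑ j ∈ range (J + 1), n.choose j * B ^ j * J.factorial := sum_mul _ _ _
    _ ≤ ∑ _j ∈ range (J + 1), (n * B) ^ J :=
        sum_le_sum fun j hj => choose_mul_pow_mul_factorial_le (Nat.lt_succ_iff.mp (mem_range.mp hj)) hJn
    _ = (J + 1) * (n * B) ^ J := by rw [sum_const, card_range, smul_eq_mul]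

end Summit.MatrixMultiplication.MatrixMultiplication.Theorems.ThresholdSubsetTriples.Negative
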